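import Summits.QuantumFields.BalabanUV.T4Continuum.Support.NE7SharpConstrainedGradientRow
import Summits.QuantumFields.BalabanUV.Beta.D1BFx.GaugeSandwichAbstract
import HarnessLib

/-!
# NE7PcTDivergenceSupOfEinv — INTERFACE REQUEST NE7 G99-IR1 (the sup letter `‖PcT·∂ᴴ g‖_∞ ≤ C‖g‖_∞` for Bałaban's (1.26) projection) REDUCED TO ONE COARSE-LATTICE INVERSE:
# through the MASSIVE representation `P = G′Q′*(Q′G′²Q′*)⁻¹Q′G′` on `1^⊥` (B5 p. 38 ∕ B9 (3.25); here a THEOREM: the three laws of D1's `GaugeSandwichAbstract` hold for it), the letter follows from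
# GAN24's scalar rows (L0) `sup_Gps`, (L1) `scalarSup_GDiv` and a UNIFORM sup bound for the inverse biharmonic block form `E⁻¹ = (Q′G′²Q′*)⁻¹` — a `SavgInverseUniform`-shaped task

Cell `pub-balaban`, sub-cell t4, lineage `b2b-balaban-t4-ne7-p1`, generation 99 (CRUX PROVER NE7 #1 = OWNER of BINDER row NE7).  Memo `t4/b2b-balaban-t4-ne7-p1-g99/ROAD-G99.md` §3.8 (A)(c) ∕ §3.9:
IR1 is the ONE displayed hypothesis of the flat energy-slice sup letter `NE7EnergySliceSupFlatOfPcT.energySlice_sup_of_pcT_letter` (p759497).  THIS FILE reduces it to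
  (E-INV)  `∃ σ, ∀ n N₀ ≥ 1, ∀ v b, ‖v‖_∞ ≤ b → ‖(Q′𝒢′²Q′*)⁻¹ v‖_∞ ≤ σ·b` on cubic tori (`𝒢′ = Gps n M 1`, `Q′* = blkInj`),
the exact analogue of `SavgInverseUniform.exists_sup_Savg_inv` for `S = Q′𝒢′Q′*` (there: Combes–Thomas on the unit torus from entry decay + uniform coercivity; for `E = Q′𝒢′²Q′*` the L² coercivity
is `⟨c, Ec⟩ = n^{−d}‖𝒢′Q′*c‖² ≥ σ₁²‖c‖²` from `ScalarAveragedCompressionSharp.form_Scomp_ge_sharp` by Cauchy–Schwarz, and the entry decay is `rowDecay_Gps` composed — NOT done here).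
WHAT ([folklore]; 0 def, 0 sorry; `E := QsOp·Gps·Gps·blkInj`, `Ph := Gps·blkInj·E⁻¹·QsOp·Gps`, written out, every torus unless said).
§1 `E_eq_smul` (`E = n^d•(Q′𝒢′²Q′ᴴ)`), `E_isHermitian`, **`isUnit_det_E`** (`a′ > 0`: `𝒢′²` is positive definite and `v ↦ v·Q′` is injective), `E_mulVec_inv`.
§2 THE THREE LAWS of `GaugeSandwichAbstract` for `Ph`: **`Ph_conjTranspose`** (H1), **`Ph_LapS_of_ker`** (H2: `Q′f = 0 ⟹ Ph(Δf) = 0`, since `𝒢′Δf = f`), **`Ph_decomp`** (H3: `b − Ph b = Δf` with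
   `f := 𝒢′(b − Ph b) ∈ ker Q′`, since `Q′𝒢′·Ph = Q′𝒢′`); hence **`PcT_GradOpH_eq_Ph`**: `PcT·∂ᴴ g = Ph·∂ᴴ g` for every vector field `g` (D1's `PcT_GradOpH_eq_of_laws` BY NAME).
§3 **`pcT_gradOpH_sup_of_Einv`** — (E-INV) ⟹ IR1 VERBATIM: `∃ C > 0, ∀ n N₀ ≥ 1, ∀ g b, ‖g‖_∞ ≤ b → ∀ y, ‖(PcT n M n·(GradOp (fine n M) n)ᴴ g)(y)‖ ≤ C·b` on cubic tori `M = fun _ ⇒ N₀`,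
   with `C = (d+1)·C₀·(|σ|+1)·C₁` from (L0), (E-INV), (L1) and `GradOpᴴ = Σ_μ ∂_μᴴ∘comp` (`B5Action121.GradOp_conjTranspose_mulVec_eq`).
HONEST FRAMING (page 1): a REDUCTION — (E-INV) is displayed, not proved; the massive representation and its laws ARE proved (linear algebra over GAN24's `Gps`∕`blkInj` and D1's abstract sandwich);
`U = 1`, scalar, flat; NOT the flat letter (that is p759497 given IR1), NOT the curved letter, NOT NE7; spine 0∕9; finite T⁴ rung (B)+1 — NOT infinite volume, NOT mass gap, NOT BetaPertH, NOT
Clay.  [B5] (1.26) p. 22 ∕ p. 38 and [B9] (3.25) are TEXT LOCATIONS; nothing printed is asserted.  Continuum YM on T⁴ ⇐ BetaPertH ∧ nine spine estimates (0/9 proved); BetaPertH ⇐ (D1) ∧ (D4) ∧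
CAP+tail; G-an2-4 gates asym, D1 and NE2/3/4.
-/

set_option autoImplicit false

open scoped BigOperators Matrix ComplexConjugate ComplexOrder

namespace Summit.QuantumFields.BalabanUV.T4Continuum.NE7PcTDivergenceSupOfEinv

open Literature.MathematicalPhysics.QuantumFieldTheory.Balaban1983to89
open B5Prop11Plancherel (Tor fine)
open B5Action121 (LapS sdiff GradOp divS comp GradOp_conjTranspose_mulVec_eq)
open B5Block118 (QsOp)
open B5Value126 (PcT)
open Summit.QuantumFields.BalabanUV.T4Continuum.ScalarAveragedPropagator (DeltaPs Gps Gps_mul_DeltaPs DeltaPs_mul_Gps DeltaPs_posDef Gps_isHermitian isUnit_det_DeltaPs)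
open Summit.QuantumFields.BalabanUV.Beta.GAN24.SoftMinimiserOneStepSup (blkInj blkInj_mulVec)
open Summit.QuantumFields.BalabanUV.Beta.GAN24.HardMinimiserOneStepSup (blkInj_eq_smul vecMul_QsOp_injective norm_QsOp_mulVec_le)
open Summit.QuantumFields.BalabanUV.Beta.GAN24.ScalarZerothLetterTorus (sup_Gps)
open Summit.QuantumFields.BalabanUV.Beta.GAN24.ScalarSupLettersCubicHolds (scalarSup_GDiv)
open Summit.QuantumFields.BalabanUV.Beta.D1BFx.GaugeSandwichAbstract (PcT_GradOpH_eq_of_laws)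
open NE7SharpConstrainedGradientRow (DeltaPs_mulVec_of_QsOp)

noncomputable section

section Algebra

variable {d : ℕ} (n : ℕ) [NeZero n] (M : Fin d → ℕ) [∀ μ, NeZero (M μ)]

/-! ## §1 The biharmonic block form `E = Q′𝒢′²Q′*` -/

/-- `E = n^d • (Q′·𝒢′²·Q′ᴴ)`. [folklore] -/
theorem E_eq_smul (a' : ℝ) :
    QsOp n M * Gps n M a' * Gps n M a' * blkInj n M = ((n : ℂ) ^ d) • (QsOp n M * Gps n M a' ^ 2 * (QsOp n M)ᴴ) := by
  rw [blkInj_eq_smul, Matrix.mul_smul, pow_two, ← Matrix.mul_assoc]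

omit [NeZero n] in
/-- `star (n^d) = n^d` in `ℂ`. [folklore] -/
theorem star_natPow : star ((n : ℂ) ^ d) = (n : ℂ) ^ d := by
  rw [star_pow, Complex.star_def, Complex.conj_natCast]

/-- `E` is Hermitian. [folklore] -/
theorem E_isHermitian (a' : ℝ) : (QsOp n M * Gps n M a' * Gps n M a' * blkInj n M)ᴴ = QsOp n M * Gps n M a' * Gps n M a' * blkInj n M := by
  have hG2 : (Gps n M a' ^ 2).IsHermitian := (Gps_isHermitian n M a').pow 2
  have hH : (QsOp n M * Gps n M a' ^ 2 * (QsOp n M)ᴴ).IsHermitian := Matrix.isHermitian_mul_mul_conjTranspose _ hG2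
  rw [E_eq_smul, Matrix.conjTranspose_smul, star_natPow, hH.eq]

/-- **`E` is invertible** (`a′ > 0`: `𝒢′²` is positive definite, `v ↦ v·Q′` is injective). [folklore] -/
theorem isUnit_det_E {a' : ℝ} (ha' : 0 < a') : IsUnit (QsOp n M * Gps n M a' * Gps n M a' * blkInj n M).det := by
  have hGh : (Gps n M a')ᴴ = Gps n M a' := (Gps_isHermitian n M a').eq
  -- `v ↦ v·(Q′𝒢′)` is injective: `v ↦ v·Q′` is, and `𝒢′` is invertible
  have hGu : IsUnit (Gps n M a') := by
    rw [Matrix.isUnit_iff_isUnit_det]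
    show IsUnit ((DeltaPs n M a')⁻¹).det
    exact Matrix.isUnit_nonsing_inv_det_iff.mpr (isUnit_det_DeltaPs n M ha')
  have hB : Function.Injective fun v : Tor M → ℂ => Matrix.vecMul v (QsOp n M * Gps n M a') := by
    intro v w h
    have h' : Matrix.vecMul (Matrix.vecMul v (QsOp n M)) (Gps n M a') = Matrix.vecMul (Matrix.vecMul w (QsOp n M)) (Gps n M a') := by
      simpa only [Matrix.vecMul_vecMul] using h
    exact vecMul_QsOp_injective n M (Matrix.vecMul_injective_iff_isUnit.mpr hGu h')
  have hP0 : (QsOp n M * Gps n M a' * (1 : Matrix (Tor (fine n M)) (Tor (fine n M)) ℂ) * (QsOp n M * Gps n M a')ᴴ).PosDef :=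
    Matrix.PosDef.one.mul_mul_conjTranspose_same hB
  have hP : (QsOp n M * Gps n M a' ^ 2 * (QsOp n M)ᴴ).PosDef := by
    have e : QsOp n M * Gps n M a' * (1 : Matrix (Tor (fine n M)) (Tor (fine n M)) ℂ) * (QsOp n M * Gps n M a')ᴴ
        = QsOp n M * Gps n M a' ^ 2 * (QsOp n M)ᴴ := by
      rw [Matrix.mul_one, Matrix.conjTranspose_mul, hGh, pow_two]
      simp only [Matrix.mul_assoc]
    rw [← e]; exact hP0
  rw [E_eq_smul, Matrix.det_smul]
  refine (IsUnit.pow _ ?_).mul ((Matrix.isUnit_iff_isUnit_det _).mp hP.isUnit)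
  exact isUnit_iff_ne_zero.mpr (pow_ne_zero _ (by exact_mod_cast NeZero.ne n))

/-- `E (E⁻¹ v) = v`. [folklore] -/
theorem E_mulVec_inv {a' : ℝ} (ha' : 0 < a') (v : Tor M → ℂ) :
    QsOp n M *ᵥ (Gps n M a' *ᵥ (Gps n M a' *ᵥ (blkInj n M *ᵥ
      ((QsOp n M * Gps n M a' * Gps n M a' * blkInj n M)⁻¹ *ᵥ v)))) = v := by
  have h : (QsOp n M * Gps n M a' * Gps n M a' * blkInj n M) *ᵥ ((QsOp n M * Gps n M a' * Gps n M a' * blkInj n M)⁻¹ *ᵥ v) = v := by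
    rw [Matrix.mulVec_mulVec, Matrix.mul_nonsing_inv _ (isUnit_det_E n M ha'), Matrix.one_mulVec]
  simpa only [← Matrix.mulVec_mulVec] using h

/-! ## §2 The three laws of the massive representation `Ph = 𝒢′Q′*E⁻¹Q′𝒢′` -/

/-- `Ph` applied to a vector, unfolded. [folklore] -/
theorem Ph_mulVec (a' : ℝ) (b : Tor (fine n M) → ℂ) :
    (Gps n M a' * blkInj n M * (QsOp n M * Gps n M a' * Gps n M a' * blkInj n M)⁻¹ * QsOp n M * Gps n M a') *ᵥ b
      = Gps n M a' *ᵥ (blkInj n M *ᵥ ((QsOp n M * Gps n M a' * Gps n M a' * blkInj n M)⁻¹ *ᵥ (QsOp n M *ᵥ (Gps n M a' *ᵥ b)))) := by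
  simp only [← Matrix.mulVec_mulVec]

/-- **(H1)** `Ph` is Hermitian. [folklore] -/
theorem Ph_conjTranspose (a' : ℝ) :
    (Gps n M a' * blkInj n M * (QsOp n M * Gps n M a' * Gps n M a' * blkInj n M)⁻¹ * QsOp n M * Gps n M a')ᴴ
      = Gps n M a' * blkInj n M * (QsOp n M * Gps n M a' * Gps n M a' * blkInj n M)⁻¹ * QsOp n M * Gps n M a' := by
  have hG : (Gps n M a')ᴴ = Gps n M a' := (Gps_isHermitian n M a').eq
  have hEH := E_isHermitian n M a'
  generalize QsOp n M * Gps n M a' * Gps n M a' * blkInj n M = E at hEH ⊢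
  rw [blkInj_eq_smul]
  simp only [Matrix.mul_smul, Matrix.smul_mul, Matrix.conjTranspose_smul, Matrix.conjTranspose_mul, Matrix.conjTranspose_conjTranspose,
    hG, Matrix.conjTranspose_nonsing_inv, hEH, star_natPow, Matrix.mul_assoc]

/-- **(H2)** `Q′f = 0 ⟹ Ph(Δf) = 0` (`𝒢′Δf = f` on `ker Q′`). [folklore] -/
theorem Ph_LapS_of_ker {a' : ℝ} (ha' : 0 < a') (f : Tor (fine n M) → ℂ) (hf : QsOp n M *ᵥ f = 0) :
    (Gps n M a' * blkInj n M * (QsOp n M * Gps n M a' * Gps n M a' * blkInj n M)⁻¹ * QsOp n M * Gps n M a')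
      *ᵥ (LapS (fine n M) (n : ℂ) *ᵥ f) = 0 := by
  have h1 : Gps n M a' *ᵥ (LapS (fine n M) (n : ℂ) *ᵥ f) = f := by
    rw [← DeltaPs_mulVec_of_QsOp n M a' hf rfl, Matrix.mulVec_mulVec, Gps_mul_DeltaPs n M ha', Matrix.one_mulVec]
  rw [Ph_mulVec, h1, hf, Matrix.mulVec_zero, Matrix.mulVec_zero, Matrix.mulVec_zero]

/-- **(H3)** for every `b`: `f := 𝒢′(b − Ph b)` has `Q′f = 0` and `b − Ph b = Δf`. [folklore] -/
theorem Ph_decomp {a' : ℝ} (ha' : 0 < a') (b : Tor (fine n M) → ℂ) :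
    ∃ f : Tor (fine n M) → ℂ, QsOp n M *ᵥ f = 0 ∧
      b - (Gps n M a' * blkInj n M * (QsOp n M * Gps n M a' * Gps n M a' * blkInj n M)⁻¹ * QsOp n M * Gps n M a') *ᵥ b
        = LapS (fine n M) (n : ℂ) *ᵥ f := by
  set r := b - (Gps n M a' * blkInj n M * (QsOp n M * Gps n M a' * Gps n M a' * blkInj n M)⁻¹ * QsOp n M * Gps n M a') *ᵥ b with hr
  have hQ : QsOp n M *ᵥ (Gps n M a' *ᵥ r) = 0 := by
    rw [hr, Matrix.mulVec_sub, Matrix.mulVec_sub, Ph_mulVec, E_mulVec_inv n M ha', sub_self]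
  refine ⟨Gps n M a' *ᵥ r, hQ, ?_⟩
  have hD : DeltaPs n M a' *ᵥ (Gps n M a' *ᵥ r) = r := by
    rw [Matrix.mulVec_mulVec, DeltaPs_mul_Gps n M ha', Matrix.one_mulVec]
  rw [← DeltaPs_mulVec_of_QsOp n M a' hQ rfl, hD]

/-- **`PcT·∂ᴴ = Ph·∂ᴴ`** (every torus, `n ≥ 1`, `a′ > 0`): D1's abstract gauge sandwich with the three laws discharged. [folklore] -/
theorem PcT_GradOpH_eq_Ph {a' : ℝ} (ha' : 0 < a') (g : Tor (fine n M) × Fin d → ℂ) :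
    PcT n M (n : ℂ) *ᵥ ((GradOp (fine n M) (n : ℂ))ᴴ *ᵥ g)
      = Gps n M a' *ᵥ (blkInj n M *ᵥ ((QsOp n M * Gps n M a' * Gps n M a' * blkInj n M)⁻¹ *ᵥ
          (QsOp n M *ᵥ (Gps n M a' *ᵥ ((GradOp (fine n M) (n : ℂ))ᴴ *ᵥ g))))) := by
  rw [← Ph_mulVec]
  exact PcT_GradOpH_eq_of_laws n M (Ph_conjTranspose n M a') (Ph_LapS_of_ker n M ha') (Ph_decomp n M ha') g

end Algebra

/-! ## §3 IR1 from (E-INV) -/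

/-- **IR1 ⇐ (E-INV)**: a uniform sup bound for `(Q′𝒢′²Q′*)⁻¹` on cubic tori (hypothesis `hE`, the shape of `SavgInverseUniform.exists_sup_Savg_inv`) gives the `PcT·∂ᴴ` sup letter
(INTERFACE REQUEST NE7 G99-IR1 verbatim) with `C = (d+1)·C₀·(|σ|+1)·C₁`. [folklore] -/
theorem pcT_gradOpH_sup_of_Einv (d : ℕ) {σ : ℝ}
    (hE : ∀ (n N₀ : ℕ) [NeZero n] [NeZero N₀], 1 ≤ n → ∀ (v : Tor (fun _ : Fin (d + 1) => N₀) → ℂ) (b : ℝ), (∀ y, ‖v y‖ ≤ b) →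
      ∀ y, ‖((QsOp n (fun _ : Fin (d + 1) => N₀) * Gps n (fun _ : Fin (d + 1) => N₀) 1 * Gps n (fun _ : Fin (d + 1) => N₀) 1
              * blkInj n (fun _ : Fin (d + 1) => N₀))⁻¹ *ᵥ v) y‖ ≤ σ * b) :
    ∃ C : ℝ, 0 < C ∧ ∀ (n N₀ : ℕ) [NeZero n] [NeZero N₀], 1 ≤ n →
      ∀ (g : Tor (fine n (fun _ : Fin (d + 1) => N₀)) × Fin (d + 1) → ℂ) (b : ℝ), (∀ i, ‖g i‖ ≤ b) →
        ∀ y, ‖(PcT n (fun _ : Fin (d + 1) => N₀) (n : ℂ) *ᵥ ((GradOp (fine n (fun _ : Fin (d + 1) => N₀)) (n : ℂ))ᴴ *ᵥ g)) y‖ ≤ C * b := by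
  obtain ⟨C₀, hC₀, hG⟩ := sup_Gps d one_pos
  obtain ⟨C₁, hC₁, hD⟩ := Summit.QuantumFields.BalabanUV.Beta.GAN24.ScalarSupLettersCubicHolds.scalarSup_GDiv (d := d) one_pos
  refine ⟨((d + 1 : ℕ) : ℝ) * C₀ * (|σ| + 1) * C₁, by positivity, fun n N₀ _ _ hn g b hg y => ?_⟩
  have hb : 0 ≤ b := (norm_nonneg _).trans (hg (0, 0))
  -- `‖𝒢′∂ᴴ g‖_∞ ≤ (d+1)·C₁·b`
  have h1 : ∀ x, ‖(Gps n (fun _ : Fin (d + 1) => N₀) 1 *ᵥ ((GradOp (fine n (fun _ : Fin (d + 1) => N₀)) (n : ℂ))ᴴ *ᵥ g)) x‖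
      ≤ ((d + 1 : ℕ) : ℝ) * C₁ * b := by
    intro x
    rw [GradOp_conjTranspose_mulVec_eq, divS, Matrix.mulVec_sum, Finset.sum_apply]
    calc ‖∑ μ : Fin (d + 1), (Gps n (fun _ : Fin (d + 1) => N₀) 1 *ᵥ
              ((sdiff (fine n (fun _ : Fin (d + 1) => N₀)) (n : ℂ) μ)ᴴ *ᵥ comp (fine n (fun _ : Fin (d + 1) => N₀)) g μ)) x‖
        ≤ ∑ μ : Fin (d + 1), ‖(Gps n (fun _ : Fin (d + 1) => N₀) 1 *ᵥ
              ((sdiff (fine n (fun _ : Fin (d + 1) => N₀)) (n : ℂ) μ)ᴴ *ᵥ comp (fine n (fun _ : Fin (d + 1) => N₀)) g μ)) x‖ := norm_sum_le _ _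
      _ ≤ ∑ _μ : Fin (d + 1), C₁ * b := Finset.sum_le_sum fun μ _ => hD n N₀ hn μ _ _ (fun z => hg (z, μ)) x
      _ = ((d + 1 : ℕ) : ℝ) * C₁ * b := by rw [Finset.sum_const, Finset.card_univ, Fintype.card_fin, nsmul_eq_mul]; push_cast; ring
  -- `Q′` does not increase the sup
  have h2 : ∀ z, ‖(QsOp n (fun _ : Fin (d + 1) => N₀) *ᵥ (Gps n (fun _ : Fin (d + 1) => N₀) 1 *ᵥ
      ((GradOp (fine n (fun _ : Fin (d + 1) => N₀)) (n : ℂ))ᴴ *ᵥ g))) z‖ ≤ ((d + 1 : ℕ) : ℝ) * C₁ * b :=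
    fun z => norm_QsOp_mulVec_le n _ _ h1 z
  -- (E-INV)
  have h3 := hE n N₀ hn _ _ h2
  -- `Q′*` does not increase the sup; then (L0)
  have h4 : ∀ x, ‖(blkInj n (fun _ : Fin (d + 1) => N₀) *ᵥ ((QsOp n (fun _ : Fin (d + 1) => N₀) * Gps n (fun _ : Fin (d + 1) => N₀) 1
      * Gps n (fun _ : Fin (d + 1) => N₀) 1 * blkInj n (fun _ : Fin (d + 1) => N₀))⁻¹ *ᵥ (QsOp n (fun _ : Fin (d + 1) => N₀) *ᵥ
        (Gps n (fun _ : Fin (d + 1) => N₀) 1 *ᵥ ((GradOp (fine n (fun _ : Fin (d + 1) => N₀)) (n : ℂ))ᴴ *ᵥ g))))) x‖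
      ≤ σ * (((d + 1 : ℕ) : ℝ) * C₁ * b) := by
    intro x; rw [blkInj_mulVec]; exact h3 _
  rw [PcT_GradOpH_eq_Ph n _ one_pos g]
  calc _ ≤ C₀ * (σ * (((d + 1 : ℕ) : ℝ) * C₁ * b)) := hG n _ _ _ h4 y
    _ ≤ ((d + 1 : ℕ) : ℝ) * C₀ * (|σ| + 1) * C₁ * b := by
        have h0 : 0 ≤ C₀ * (((d + 1 : ℕ) : ℝ) * C₁ * b) := by positivity
        have hs : σ ≤ |σ| + 1 := (le_abs_self σ).trans (le_add_of_nonneg_right zero_le_one)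
        have := mul_le_mul_of_nonneg_left hs h0
        nlinarith [this]

end

end Summit.QuantumFields.BalabanUV.T4Continuum.NE7PcTDivergenceSupOfEinv
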